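import Summits.BirchSwinnertonDyer.BirchSwinnertonDyer.Theses.ShadowIsolation
import Literature.NumberTheory.EllipticCurves.ModPIrreducibleCofinite

/-!
# BirchSwinnertonDyer / ShadowIsolation — support item `PrimeSupplyIrreducible` (stmt-BirchSwinnertonDyer-15491)

Every globally minimal elliptic `W/ℚ` has a prime `p ≥ 5` of good ordinary reduction at which `E[p]` is an
irreducible `Γ_ℚ`-module. This is the proved tree theorem
`WeierstrassCurve.exists_gt_mem_goodOrdinaryPrimes_hasIrreducibleModPGaloisRep` (Silverman, *AEC*,
Cor. IX.6.3 over `ℚ`: `E[p]` is irreducible for all but finitely many `p`; with the infinitude of good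
ordinary primes, Serre 1981 §8 / elementary), specialised at the bound `N = 4`. Filed by lead c3 of crux
stmt-15277 (`ShaCotorsionReducible`): with this item in the deciding theorem in place of that crux
(`Cruxes/ShaCotorsionReducible/ClosesWithSupply.lean`) the residual Eisenstein sector is never entered.
-/

-- D-0017: single-problem summit, so `Summit.BirchSwinnertonDyer.BirchSwinnertonDyer.…` repeats a
-- namespace BY DESIGN.
set_option linter.dupNamespace false

namespace Summit.BirchSwinnertonDyer.BirchSwinnertonDyer.Theorems

open Summit.BirchSwinnertonDyer.BirchSwinnertonDyer.Theses

/-- **`PrimeSupplyIrreducible` (stmt-BirchSwinnertonDyer-15491).** Every globally minimal elliptic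
`W/ℚ` has a good ordinary prime `p ≥ 5` with `E[p]` irreducible: the tree theorem
`WeierstrassCurve.exists_gt_mem_goodOrdinaryPrimes_hasIrreducibleModPGaloisRep W 4` (AEC Cor. IX.6.3
plus infinitely many good ordinary primes), unpacked. [cite: SilvermanAEC2009, Cor. IX.6.3] -/
theorem primeSupplyIrreducible_proof : ShadowIsolation.PrimeSupplyIrreducible := by
  intro W _ _
  obtain ⟨p, h4p, ⟨hp, hgood, hord⟩, hirr⟩ :=
    WeierstrassCurve.exists_gt_mem_goodOrdinaryPrimes_hasIrreducibleModPGaloisRep W 4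
  exact ⟨p, hp, h4p, hgood, hord, hirr⟩

end Summit.BirchSwinnertonDyer.BirchSwinnertonDyer.Theorems
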